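import Literature.NumberTheory.LFunctions.Zhang2022.RepairRplus
import Literature.NumberTheory.LFunctions.Zhang2022.RepairAdmissibleWide

/-!
# Zhang (2022) §18-margin repair rung — barrier extension «LENGTHS `≥ P` WITH ONLY IN-PRINT
# OFF-DIAGONAL INPUT»: the printed off-diagonal range of formula I is EXACTLY the wall `P`

Trunk T-ANT (NumberTheory/LFunctions). Y. Zhang, *Discrete mean estimates and the Landau–Siegel
zero*, arXiv:2211.02515v1 (2022) [Zhang2022LandauSiegel] — **an unrefereed manuscript under
adjudication. WHAT THIS IS NOT: nothing here asserts or denies its Theorems 1–2 or any analytic lemma;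
no claim about Landau–Siegel zeros, about Parity, or about a repaired `Margin232` is made. Every
statement below is about the manuscript's METHOD AS ARCHITECTED — the class of parametrised designs
`θ` fed to the SAME main-term calculus — not about zeros of `L`-functions.** Cell `landau-siegel`
(rung F-S3), sub-cell E (barrier extension), seat p4, stub S-E-p4-1 of `barrier/ASSIGNMENTS.md`
(writer ls-barrier-plan): «K = `AdmissibleTheta` with `belowP` RELAXED; displayed slot
`InPrintOffDiagonalRange θ`; `InPrintOffDiagonalRange θ → θ.belowP` ⇒ verdict via
`not_repairable_true_need`; `familyInPrintLen` + `_decided`». Extension protocol of `RepairRplus` (p455670).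

## The class `K = R_len` (membership only; no analytic hypothesis inside)

`AdmissibleThetaLen θ` := `Repair.AdmissibleTheta θ` (p421602) with the ONE conjunct `belowP : ν₁ < 1`
DELETED and every other conjunct verbatim: `ν₃ < ν₂ < ν₁` (`orderedLengths`), `ν₃ < ½`, `ν₂ ≤ ½ < ν₁`
(`straddleHalf`), `1 < ν₁ + ν₃` (`dualRangesNonempty`), `cut₁ = ½` (`cutAtHalf`), `0 < k_j < 5`
(`shiftsInContour`), `k₁ = k₃` (`tiedOuterShifts`); `ι ∈ ℂ³` free. The mollifier exponent `ν₁` of the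
`H₁₁`-piece `ϰ₁` ((2.23), (8.6): length `P₁ = P^{ν₁}`) is unbounded above: the designs «of length `≥ P`»
are the members with `ν₁ ≥ 1` (`thetaLen ν`, `admissibleThetaLen_thetaLen`).

## Where the wall `ν₁ < 1` comes from in print: the off-diagonal of formula I

`belowP` is the support condition (7.2) «`a(n) = 0` if `n ≥ PT⁻²`» (tex L1814) for the coefficient
sequences `a₁₁, a₂₁` of `H₁₁` fed to Proposition 7.1 in (8.7)–(8.8) (tex L2318–L2322). In the PROOF of
Proposition 7.1 the characters are summed first: `Σ*_ψ τ(ψ̄)ψ(l)ψ̄(k) = p·e(l k̄/p) + O(1)` (tex L1953),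
reciprocity turns this into the Kloosterman fraction `e(−l p̄/k)` (tex L1962–L1970), and (7.8) is the
TRILINEAR form `Σ_d d⁻¹ Σ_l Σ_{(k,l)=1} (κ∗a₁)(dl)·b(dk)k⁻¹·e(−l p̄/k)·Δ(l/(pk))`, summed over the primes
`p ∼ P` with `p^{β₃}`, in the three variables NUMERATOR `l` (long: `l ∈ 𝔌(Rh) = [⅓Pt₀Rh, 4Pt₀Rh]`, tex
L2033, Lemma 5.1/5.3), INVERTED VARIABLE `p ≍ P` (primes) and MODULUS `k = hr` with `dk = dhr < P₁`
(tex L2008: the support of `a₂₁`). Expanding `e(−l p̄/k)` in characters `θ mod k` (tex L1975) gives the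
main term `𝔗₁₁` (principal `θ`) and the OFF-DIAGONAL error `𝔗₁₂`, bounded in (7.12)–(7.15) by «the
Mellin transform, Lemma 5.4 (i) and the large sieve inequality» (tex L1990–L2058): for the dyadic block
of moduli `R ≤ r < 2R`, `D ≤ R < P₁/(dh)` (tex L2028),
`R^{−3/2} Σ_{r} Σ*_{θ} |𝔰*| ≪ τ₅(d) h 𝓛^c (R^{1/2}P^{3/2} + R^{−1/2}P²) ≪ τ₅(d) h P² D^{−c}` (tex L2055)
— the LAST `≪` being the range condition `R ≤ P·D^{−2c}𝓛^{−2c}`; the moduli `1 < r < D` are Lemma 5.6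
(tex L2013–L2023). In the audit tree this chain is typed and proved under (A) on the printed support:
`Section7cStatements.InRange735`, `Step7u039`–`Step7u041`, `Eq715`, `step7u039X`, `sum_tripleX_le`,
`eq711X_holds` (p436190), `prop71X_holds` (p436600) — ranges `R·dh ≤ PT⁻²`, budget `R^{1/2} ≤ P^{1/2}T⁻¹`.
The same trilinear shape `Σ β_p κ(l) e(−l p̄/(modulus))` is the (14.4)–(14.8) object of the `ℓ`-lever
(theory/ELL-CENSUS.md §§0, 4: «one technology behind both long levers»); there the ranges are governed by
`(log P/log D, log T/log D)`, not by `ν₁`, and that instance is not typed here (stub S-E-p4-2, parked).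

## The displayed slot: «only in-print off-diagonal input» as exponent inequalities (kind (c))

EXPONENT MODEL (RECONSTRUCTED desk bookkeeping, labelled as such; the convention of `RepairAdmissible`:
`P`-exponents only, every `D`-, `T`-, `t₀`-, `𝓛`-power is `P^{o(1)}` since `P = exp 𝓛⁹`; a printed
bound CONTROLS a block iff its `P`-exponent is STRICTLY below the target's, a tie being lost to the
`D^{−c}` the target demands). A design `θ` generates dyadic modulus blocks `R = P^ρ` for EVERY
`ρ ∈ [0, ν₁]` (`modulusExponents θ = Icc 0 ν₁`: `r < P₁/(dh)` with `d = h = 1`, the sup attained as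
`D → ∞`); the block's trilinear form has numerator length `A = P^{1+ρ}` (`𝔌(R)`), inverted-variable
length `M = P` (primes), modulus length `N = P^ρ`, coefficients `|ν_l| ≤ P^{o(1)}`, `|α_p| = 1`
(`Re β₃ = 0`), `|β_k| ≤ k⁻¹`, weight `|Δ| ≤ P^{o(1)}` on `𝔌` (tex L2010: `Δ(l/(phr)) ≪ 𝓛^c hr/l × …`);
the target for a block with `ρ > 0` is `o(P²)·D^{−c}` (the block's share of `Σ_p p^{β₃}𝔗₁₂(p) = o(𝔓)`,
`𝔓 ≍ P²𝓛⁻⁷⁷`, (7.11)), i.e. `P`-exponent `< 2`. The in-print inputs and their exponents: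

* `SmallModuliControlled ρ := ρ = 0` — moduli of size `P^{o(1)}`: `1 < r < D` by Lemma 5.6 (prime character
  sums, tex L2013), `D ≤ r ≤ P^{o(1)}` by the large sieve's second branch `R^{−1/2}P² ≤ D^{−1/2}P²`;
  tree: `Section7cStatements.sum_tripleX_smallR_le`.
* `LargeSieveControls ρ := lsExponent ρ < 2`, `lsExponent ρ = 3/2 − ρ/2 + ½max(ρ−1,0) + ½max(2ρ,1)`
  — the multiplicative large sieve on both factors + Cauchy exactly as in §7.u039–u041 for EVERY `R`:
  `l`-side `((R² + N_l)·R²/N_l)^{1/2}`, `N_l = P^{1+ρ}` (the factor `R² = (hr)²` is Lemma 5.4 (i)'s `hr/l`,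
  tex L2010), `p`-side `((R² + P)P³)^{1/2}`, prefactor `R^{−3/2}`; on `[0,1]` this IS the printed
  `max(ρ/2 + 3/2, 2 − ρ/2)` (`lsExponent_eq_printed`), beyond `1` it is `ρ + 1`. The large sieve
  itself is PROVED in tree (`Literature.NumberTheory.Sieve.LargeSieve.largeSieve_character_nat`, used by
  `Zhang2022.largeSieve_meanValue` and the §7 lane `Section7cLPolyLargeSieve` / `step7u039X`).
* `DFIControls ρ := dfiExponent ρ < 2`, `dfiExponent ρ = 15/8 + 7ρ/8 + (11/48)·max(1,ρ)` — the IN-TREE fact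
  `Literature.NumberTheory.LFunctions.DukeFriedlanderIwaniec1997_bilinearKloostermanFractions`
  (DeterminantEquationDFI.lean:119; `_holds` PROVED, DeterminantEquationDFIProofs.lean:534):
  `‖Σ_{(m,n)=1} α_mβ_n e(k m̄/n + X/mn)‖ ≤ K‖α‖‖β‖(1+|X|/MN)(|k|+MN)^{3/8}(M+N)^{11/48+ε}`, applied to the
  `(p,k)`-bilinear form of each block at FIXED numerator `l` (`m ↔ p`, `n ↔ k`, `k ↔ −l`; `‖α‖ = P^{1/2}`,
  `‖β‖ = P^{−ρ/2}`, `|k| + MN = P^{1+ρ+o(1)}`, `M + N = P^{max(1,ρ)}`) and summed trivially over the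
  `P^{1+ρ}` numerators.
* `BCControls ρ := bcExponent ρ < 2`, `bcExponent ρ = 1 + max((7/20)(2+2ρ) + ¼max(1,ρ),
  (3/8)(2+2ρ) + ⅛(1+ρ+max(1,ρ)))` — the IN-TREE fact
  `Literature.NumberTheory.LFunctions.BettinChandee2018_trilinearKloostermanFractions`
  (BettinChandee2018TrilinearKloostermanFractions.lean:62):
  `𝓑(M,N,A) ≤ K‖α‖‖β‖‖ν‖(1+|ϑ|A/MN)^{1/2}((AMN)^{7/20+ε}(M+N)^{1/4} + (AMN)^{3/8+ε}(AN+AM)^{1/8})`,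
  applied to the whole block (`a ↔ l`, `m ↔ p`, `n ↔ k`, `ϑ = −1`; `‖α‖‖β‖‖ν‖ = P^{1/2−ρ/2+(1+ρ)/2} = P`,
  `(1+|ϑ|A/MN)^{1/2} = t₀^{1/2} = P^{o(1)}`).

**`InPrintOffDiagonalRange θ := ∀ ρ ∈ modulusExponents θ, SmallModuliControlled ρ ∨ LargeSieveControls ρ
∨ DFIControls ρ ∨ BCControls ρ`** — «every off-diagonal block the design generates is controlled by an
input that is in print (and in the tree)». A bare `Prop` about exponents; it is NOT `Eq148DUniform`
(registry E-016, a conjectured extension) and it does not contain `ν₁ < 1` as a conjunct.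

## Theorems

* `largeSieveControls_iff : LargeSieveControls ρ ↔ 0 < ρ ∧ ρ < 1` — the printed large-sieve range;
  `two_lt_dfiExponent`, `two_le_bcExponent`: for `ρ ≥ 0` neither Kloosterman-fraction fact controls ANY
  block of this form (they save `P^{ρ/8}`-type factors over the trivial `P^{2+ρ}`; the block needs `P^{ρ}·D^c`
  — consistent with ls-ref-1's E-016 price run «BC18 saves `P^{1/8}` vs needed `≈ P·D^{1/2−2B}`»);
  `not_inPrintControlled_of_one_le : 1 ≤ ρ → ¬(… ∨ … ∨ … ∨ …)` — **no in-print input reaches a block at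
  or beyond the wall**.
* **`belowP_of_inPrintOffDiagonalRange : 0 ≤ θ.nu1 → InPrintOffDiagonalRange θ → θ.belowP`** (take the top
  block `ρ = ν₁`) — the in-print ranges FORCE `ν₁ < 1`: the slot routes every design of `K` that uses only
  in-print off-diagonal input into `R`; conversely `inPrintOffDiagonalRange_of_belowP` (`0 ≤ ν₁ < 1 ⇒` slot:
  the slot is no narrowing of `R`), whence `inPrintOffDiagonalRange_iff_belowP` — THE PRINTED RANGE IS
  EXACTLY THE WALL.
* **`not_repairable_inPrint_lengths : ∀ θ, AdmissibleThetaLen θ → InPrintOffDiagonalRange θ →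
  ¬ (C232S θ * C233T θ < ‖dSumS θ‖ ^ 2)`** via `Repair.not_repairable_true_need` (p428635), with the CS
  companion `normSq_dSumS_le_inPrint` and the printed-chain companion; `familyInPrintLen` + `_decided`,
  `rplus_inPrintLen_decided : ClassDecided (Rplus ++ [familyInPrintLen])`; C2 embeddings
  `AdmissibleTheta.toLen`, `inPrintOffDiagonalRange_of_admissible`; C4 witnesses `theta0` (slot holds,
  `inPrintOffDiagonalRange_theta0`) and `thetaLen ν`, `ν ≥ 1` (in `K`, slot FAILS:
  `not_inPrintOffDiagonalRange_thetaLen` — the slot is load-bearing).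
* Boundary bonus: `not_repairable_len_of_le_one` — a design of `K` with `ν₁ ≤ 1` (length EXACTLY `P`
  included) lies in `R_calc` (`RepairAdmissibleWide.AdmissibleThetaCalc`, p456882) and the verdict holds by
  the calculus alone (`not_repairable_true_need_calc`): the calculus decides up to and including the wall, the
  printed off-diagonal input stops STRICTLY before it (`D^{−2c}` margin), and beyond it neither speaks.

CURRENCY (C3(e) of barrier/REF-E.md): T-true with the tree's functionals `C232S`/`C233T`/`dSumS`. The
theorems NEVER evaluate them at a design with `ν₁ > 1` (where the `ϰ₁`-profile leaves `[0,1]` and these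
`[0,1]`-forms stop being the design's continued calculus): the slot sends every in-print design into `R`
(validity of the dictionary on `R` = the p428635 chain; off `R`: registry E-017 open). For the members of
`K` beyond the wall NOTHING is claimed — their main terms need an off-diagonal input of E*-len strength
(registry E-001/E-002) that no printed bound supplies (`not_inPrintControlled_of_one_le`). Numerical
certificates consumed: none (structural; the exponents are the printed rationals, compared by `norm_num`).

## References

* Y. Zhang, arXiv:2211.02515v1 (2022), §2 (2.21)–(2.27), Props. 2.4–2.6, (2.32)–(2.33); §5 Lemmas 5.1,
  5.3, 5.4, 5.6; §7 Prop. 7.1, (7.2), (7.6)–(7.15), tex L1813–L2058 [pp. 36–39]; §8 (8.6)–(8.8), Lemmas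
  8.2, 8.4 [tex L2286–L2398]. [cite: Zhang2022LandauSiegel, §§2, 5, 7, 8]
* W. Duke, J. Friedlander, H. Iwaniec, *Bilinear forms with Kloosterman fractions*, Invent. Math. 128
  (1997) 23–43, Theorem 2. [cite: DukeFriedlanderIwaniec1997, Theorem 2]
* S. Bettin, V. Chandee, *Trilinear forms with Kloosterman fractions*, Adv. Math. 328 (2018) 1234–1262,
  Theorem 1. [cite: BettinChandee2018, Theorem 1]
-/

noncomputable section

open Real Complex ComplexConjugate Set

namespace Literature.NumberTheory.LFunctions.Zhang2022

namespace Repair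

variable {θ : Theta} {ρ : ℝ}

/-! ### The class `K = R_len`: `AdmissibleTheta` with `belowP` deleted -/

/-- **The extension class `R_len` («lengths `≥ P` admitted»)**: `Repair.AdmissibleTheta` with the conjunct
`belowP : ν₁ < 1` ((7.2) for `H₁₁`) DELETED and every other conjunct verbatim — `orderedLengths`,
`straddleHalf`, `dualRangesNonempty`, `cutAtHalf`, `shiftsInContour`, `tiedOuterShifts`; `ι ∈ ℂ³` free.
[cite: Zhang2022LandauSiegel, §2 (2.21)–(2.26); §7 (7.2); §12 (12.1)] -/
def AdmissibleThetaLen (θ : Theta) : Prop :=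
  θ.orderedLengths ∧ θ.straddleHalf ∧ θ.dualRangesNonempty ∧ θ.cutAtHalf ∧ θ.shiftsInContour ∧
    θ.tiedOuterShifts

/-- **`R ⊆ R_len`** (the C2 embedding: drop one conjunct). [cite: Zhang2022LandauSiegel, §2 (2.21)–(2.26)] -/
theorem AdmissibleTheta.toLen (h : AdmissibleTheta θ) : AdmissibleThetaLen θ := by
  obtain ⟨ho, hs, -, hd, hc, hk, ht⟩ := h
  exact ⟨ho, hs, hd, hc, hk, ht⟩

/-- `R_len` together with the wall `ν₁ < 1` IS `R`. [cite: Zhang2022LandauSiegel, §2 (2.21)–(2.26); §7 (7.2)] -/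
theorem AdmissibleThetaLen.toAdmissible (h : AdmissibleThetaLen θ) (hP : θ.belowP) : AdmissibleTheta θ := by
  obtain ⟨ho, hs, hd, hc, hk, ht⟩ := h
  exact ⟨ho, hs, hP, hd, hc, hk, ht⟩

/-- On `R_len` the `H₁₁`-exponent is positive: `1/2 < ν₁` (from `straddleHalf`).
[cite: Zhang2022LandauSiegel, §12 (12.1)–(12.2)] -/
theorem AdmissibleThetaLen.half_lt_nu1 (h : AdmissibleThetaLen θ) : 1 / 2 < θ.nu1 := h.2.1.2.2

/-- A member of `R_len` of length `≤ P` (wall INCLUDED: `ν₁ ≤ 1`) lies in the calculus class `R_calc` of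
`RepairAdmissibleWide` (`0 < ν₃` from `1 < ν₁ + ν₃`; `k_j ≠ 0` from `0 < k_j`).
[cite: Zhang2022LandauSiegel, §2 (2.21)–(2.26)] -/
theorem AdmissibleThetaLen.toCalc (h : AdmissibleThetaLen θ) (h1 : θ.nu1 ≤ 1) : AdmissibleThetaCalc θ := by
  obtain ⟨⟨h32, h21⟩, -, hd, -, ⟨⟨hk1, -⟩, ⟨hk2, -⟩, ⟨hk3, -⟩⟩, -⟩ := h
  unfold Theta.dualRangesNonempty at hd
  exact ⟨by linarith, h32.le, h21, h1, hk1.ne', hk2.ne', hk3.ne'⟩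

/-! ### The exponent model of the formula-I off-diagonal and the in-print inputs -/

/-- The exponents `ρ` of the dyadic modulus blocks `R = P^ρ` that the design generates in (7.13)/(7.15):
`k = hr`, `dhr < P₁ = P^{ν₁}` — every `ρ ∈ [0, ν₁]` (the sup is attained as `D → ∞`).
[cite: Zhang2022LandauSiegel, §7 (7.13), (7.15), p.38] -/
def modulusExponents (θ : Theta) : Set ℝ := Icc 0 θ.nu1

/-- Small moduli `r ≤ P^{o(1)}` (`ρ = 0`): `1 < r < D` by Lemma 5.6, `D ≤ r` by the large sieve's branch
`R^{−1/2}P² ≤ D^{−1/2}P²` — controlled in print (tree: `Section7cStatements.sum_tripleX_smallR_le`).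
[cite: Zhang2022LandauSiegel, §7 (7.14)–(7.15), p.38; §5 Lemma 5.6] -/
def SmallModuliControlled (ρ : ℝ) : Prop := ρ = 0

/-- The `P`-exponent of the multiplicative-large-sieve + Cauchy bound of §7.u039–u041 for the block
`R = P^ρ` (prefactor `R^{−3/2}`, factor `hr ≍ R`, `l`-side `((R² + N_l)/N_l)^{1/2}` with `N_l = P^{1+ρ}`,
`p`-side `((R² + P)P³)^{1/2}`): `3/2 − ρ/2 + ½max(ρ−1, 0) + ½max(2ρ, 1)`.
[cite: Zhang2022LandauSiegel, §7 (7.15) and tex L2043–L2058, p.38–39] -/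
def lsExponent (ρ : ℝ) : ℝ := 3 / 2 - ρ / 2 + max (ρ - 1) 0 / 2 + max (2 * ρ) 1 / 2

/-- «The large sieve controls the block `P^ρ`»: its exponent is strictly below the target's `2`
(`τ₅(d)hP²D^{−c}`, tex L2055). [cite: Zhang2022LandauSiegel, §7 (7.15), p.38] -/
def LargeSieveControls (ρ : ℝ) : Prop := lsExponent ρ < 2

/-- The `P`-exponent of Duke–Friedlander–Iwaniec's bound (in tree:
`DukeFriedlanderIwaniec1997_bilinearKloostermanFractions`) on the block `P^ρ`: bilinear in `(p,k)` at
fixed numerator `l` — `‖α‖‖β‖ = P^{1/2−ρ/2}`, `(|l| + MN)^{3/8} = P^{3(1+ρ)/8}`, `(M+N)^{11/48} =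
P^{11max(1,ρ)/48}` — summed over the `P^{1+ρ}` numerators: `15/8 + 7ρ/8 + (11/48)max(1,ρ)`.
[cite: DukeFriedlanderIwaniec1997, Theorem 2] -/
def dfiExponent (ρ : ℝ) : ℝ := 15 / 8 + 7 * ρ / 8 + 11 / 48 * max 1 ρ

/-- «DFI97 controls the block `P^ρ`»: `dfiExponent ρ < 2`. [cite: DukeFriedlanderIwaniec1997, Theorem 2] -/
def DFIControls (ρ : ℝ) : Prop := dfiExponent ρ < 2

/-- The `P`-exponent of Bettin–Chandee's trilinear bound (in tree:
`BettinChandee2018_trilinearKloostermanFractions`) on the block `P^ρ` with `(A, M, N) = (P^{1+ρ}, P, P^ρ)`: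
`‖α‖‖β‖‖ν‖ = P`, `(1 + |ϑ|A/MN)^{1/2} = P^{o(1)}`, and the two printed terms
`(AMN)^{7/20}(M+N)^{1/4}`, `(AMN)^{3/8}(AN+AM)^{1/8}`. [cite: BettinChandee2018, Theorem 1] -/
def bcExponent (ρ : ℝ) : ℝ :=
  1 + max (7 / 20 * (2 + 2 * ρ) + 1 / 4 * max 1 ρ) (3 / 8 * (2 + 2 * ρ) + 1 / 8 * (1 + ρ + max 1 ρ))

/-- «BC18 controls the block `P^ρ`»: `bcExponent ρ < 2`. [cite: BettinChandee2018, Theorem 1] -/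
def BCControls (ρ : ℝ) : Prop := bcExponent ρ < 2

/-- **The displayed E*-slot «only in-print off-diagonal input» (kind (c))**: every off-diagonal block the
design generates in formula I is controlled by one of the inputs in print — small moduli (Lemma 5.6),
the multiplicative large sieve ((7.15)), Duke–Friedlander–Iwaniec 1997, Bettin–Chandee 2018. A bare
`Prop` over exponents; not `Eq148DUniform` (E-016); no `ν₁ < 1` conjunct.
[cite: Zhang2022LandauSiegel, §7 (7.11)–(7.15), p.37–39] -/
def InPrintOffDiagonalRange (θ : Theta) : Prop :=
  ∀ ρ ∈ modulusExponents θ,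
    SmallModuliControlled ρ ∨ LargeSieveControls ρ ∨ DFIControls ρ ∨ BCControls ρ

/-! ### What each in-print input reaches -/

/-- On `[0,1]` the large-sieve exponent is the printed `max(R^{1/2}P^{3/2}, R^{−1/2}P²)`-exponent
`max(ρ/2 + 3/2, 2 − ρ/2)`. [cite: Zhang2022LandauSiegel, §7 tex L2055, p.39] -/
theorem lsExponent_eq_printed (h1 : ρ ≤ 1) :
    lsExponent ρ = max (ρ / 2 + 3 / 2) (2 - ρ / 2) := by
  unfold lsExponent
  rw [max_eq_right (by linarith : ρ - 1 ≤ 0)]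
  rcases le_total (2 * ρ) 1 with h | h
  · rw [max_eq_right h, max_eq_right (by linarith : ρ / 2 + 3 / 2 ≤ 2 - ρ / 2)]; ring
  · rw [max_eq_left h, max_eq_left (by linarith : 2 - ρ / 2 ≤ ρ / 2 + 3 / 2)]; ring

/-- At and beyond the wall the large-sieve exponent is `ρ + 1 ≥ 2`.
[cite: Zhang2022LandauSiegel, §7 tex L2047–L2055, p.39] -/
theorem lsExponent_eq_of_one_le (h1 : 1 ≤ ρ) : lsExponent ρ = ρ + 1 := by
  unfold lsExponent
  rw [max_eq_left (by linarith : 0 ≤ ρ - 1), max_eq_left (by linarith : (1:ℝ) ≤ 2 * ρ)]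
  ring

/-- **The printed large-sieve range is `0 < ρ < 1`** (i.e. `P^{o(1)}·D^{O(1)} < R < P·D^{−2c}`).
[cite: Zhang2022LandauSiegel, §7 (7.15), tex L2028, L2055, p.38–39] -/
theorem largeSieveControls_iff : LargeSieveControls ρ ↔ 0 < ρ ∧ ρ < 1 := by
  unfold LargeSieveControls lsExponent
  constructor
  · intro h
    have hA := le_max_right (ρ - 1) 0
    have hB := le_max_right (2 * ρ) 1
    have hC := le_max_left (ρ - 1) 0
    have hD := le_max_left (2 * ρ) 1
    constructor
    · linarith
    · linarith
  · rintro ⟨h0, h1⟩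
    rw [max_eq_right (by linarith : ρ - 1 ≤ 0)]
    rcases le_total (2 * ρ) 1 with h | h
    · rw [max_eq_right h]; linarith
    · rw [max_eq_left h]; linarith

/-- Duke–Friedlander–Iwaniec's bound never reaches ANY block of this form: `dfiExponent ρ > 2` for `ρ ≥ 0`
(already `101/48` at `ρ = 0`). [cite: DukeFriedlanderIwaniec1997, Theorem 2] -/
theorem two_lt_dfiExponent (h0 : 0 ≤ ρ) : 2 < dfiExponent ρ := by
  unfold dfiExponent
  have h := le_max_left 1 ρ
  nlinarith

/-- … so `DFIControls ρ` fails for every `ρ ≥ 0`. [cite: DukeFriedlanderIwaniec1997, Theorem 2] -/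
theorem not_dfiControls (h0 : 0 ≤ ρ) : ¬ DFIControls ρ := fun h => by
  unfold DFIControls at h
  linarith [two_lt_dfiExponent h0]

/-- Bettin–Chandee's bound never reaches ANY block of this form: `bcExponent ρ ≥ 2` for `ρ ≥ 0` (it saves
`P^{ρ/8}` over the trivial `P^{2+ρ}`). [cite: BettinChandee2018, Theorem 1] -/
theorem two_le_bcExponent (h0 : 0 ≤ ρ) : 2 ≤ bcExponent ρ := by
  unfold bcExponent
  have h := le_max_left 1 ρ
  have h2 : 1 ≤ 3 / 8 * (2 + 2 * ρ) + 1 / 8 * (1 + ρ + max 1 ρ) := by linarith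
  linarith [le_max_right (7 / 20 * (2 + 2 * ρ) + 1 / 4 * max 1 ρ)
    (3 / 8 * (2 + 2 * ρ) + 1 / 8 * (1 + ρ + max 1 ρ))]

/-- … so `BCControls ρ` fails for every `ρ ≥ 0`. [cite: BettinChandee2018, Theorem 1] -/
theorem not_bcControls (h0 : 0 ≤ ρ) : ¬ BCControls ρ := fun h => by
  unfold BCControls at h
  linarith [two_le_bcExponent h0]

/-- **No in-print input reaches a block at or beyond the wall** (`ρ ≥ 1`, moduli `≥ P^{1−o(1)}`).
[cite: Zhang2022LandauSiegel, §7 (7.15), tex L2055, p.39] -/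
theorem not_inPrintControlled_of_one_le (h1 : 1 ≤ ρ) :
    ¬ (SmallModuliControlled ρ ∨ LargeSieveControls ρ ∨ DFIControls ρ ∨ BCControls ρ) := by
  rintro (h | h | h | h)
  · unfold SmallModuliControlled at h; linarith
  · exact absurd (largeSieveControls_iff.1 h).2 (not_lt.2 h1)
  · exact not_dfiControls (by linarith) h
  · exact not_bcControls (by linarith) h

/-- Below the wall every block is controlled in print: `ρ = 0` by the small-moduli inputs, `0 < ρ < 1` by
the large sieve. [cite: Zhang2022LandauSiegel, §7 (7.14)–(7.15), p.38–39] -/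
theorem inPrintControlled_of_lt_one (h0 : 0 ≤ ρ) (h1 : ρ < 1) :
    SmallModuliControlled ρ ∨ LargeSieveControls ρ ∨ DFIControls ρ ∨ BCControls ρ := by
  rcases h0.eq_or_lt with h | h
  · exact Or.inl h.symm
  · exact Or.inr (Or.inl (largeSieveControls_iff.2 ⟨h, h1⟩))

/-! ### The slot is exactly the wall -/

/-- **The in-print off-diagonal ranges force `ν₁ < 1`** (apply the slot to the top block `ρ = ν₁`).
[cite: Zhang2022LandauSiegel, §7 (7.2), (7.15), p.36–39] -/
theorem belowP_of_inPrintOffDiagonalRange (h0 : 0 ≤ θ.nu1) (h : InPrintOffDiagonalRange θ) : θ.belowP := by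
  have htop : θ.nu1 ∈ modulusExponents θ := ⟨h0, le_rfl⟩
  have hc := h θ.nu1 htop
  unfold Theta.belowP
  by_contra hge
  exact not_inPrintControlled_of_one_le (not_lt.1 hge) hc

/-- Conversely every design with `0 ≤ ν₁ < 1` satisfies the slot (the slot does not narrow `R`).
[cite: Zhang2022LandauSiegel, §7 (7.2), (7.15), p.36–39] -/
theorem inPrintOffDiagonalRange_of_belowP (hP : θ.belowP) : InPrintOffDiagonalRange θ := by
  intro ρ hρ
  unfold Theta.belowP at hP
  exact inPrintControlled_of_lt_one hρ.1 (lt_of_le_of_lt hρ.2 hP)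

/-- **THE PRINTED RANGE IS EXACTLY THE WALL**: for `ν₁ ≥ 0`, `InPrintOffDiagonalRange θ ↔ ν₁ < 1`.
[cite: Zhang2022LandauSiegel, §7 (7.2), (7.15), p.36–39] -/
theorem inPrintOffDiagonalRange_iff_belowP (h0 : 0 ≤ θ.nu1) : InPrintOffDiagonalRange θ ↔ θ.belowP :=
  ⟨belowP_of_inPrintOffDiagonalRange h0, inPrintOffDiagonalRange_of_belowP⟩

/-- Every class-`R` design carries the slot. [cite: Zhang2022LandauSiegel, §7 (7.2), p.36] -/
theorem inPrintOffDiagonalRange_of_admissible (h : AdmissibleTheta θ) : InPrintOffDiagonalRange θ :=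
  inPrintOffDiagonalRange_of_belowP h.2.2.1

/-- A design of `R_len` using only in-print off-diagonal input is a design of `R`.
[cite: Zhang2022LandauSiegel, §2 (2.21)–(2.26); §7 (7.2), (7.15)] -/
theorem admissible_of_len_inPrint (h : AdmissibleThetaLen θ) (hs : InPrintOffDiagonalRange θ) :
    AdmissibleTheta θ :=
  h.toAdmissible (belowP_of_inPrintOffDiagonalRange (by linarith [h.half_lt_nu1]) hs)

/-! ### The verdict theorems -/

/-- **NOT-REPAIRABLE with lengths `≥ P` admitted and only in-print off-diagonal input.** For every design
of `R_len` (class `R` with the wall `ν₁ < 1` deleted) whose formula-I off-diagonal blocks are all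
controlled by printed inputs (displayed slot `InPrintOffDiagonalRange θ`), the joint main-order criterion
of the §2 endgame fails: `¬ (C₂₃₂(θ)·C₂₃₃(θ) < |𝔡+𝔡′|²(θ))` — the slot forces `ν₁ < 1`
(`belowP_of_inPrintOffDiagonalRange`) and on `R` this is `Repair.not_repairable_true_need` (p428635).
Closing with a length `≥ P` therefore needs an off-diagonal input beyond everything in print
(`not_inPrintControlled_of_one_le`). [cite: Zhang2022LandauSiegel, §2 Props. 2.4–2.6, (2.32)–(2.33); §7 (7.2), (7.15)] -/
theorem not_repairable_inPrint_lengths :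
    ∀ θ, AdmissibleThetaLen θ → InPrintOffDiagonalRange θ → ¬ (C232S θ * C233T θ < ‖dSumS θ‖ ^ 2) :=
  fun _ h hs => not_repairable_true_need _ (admissible_of_len_inPrint h hs)

/-- Cauchy–Schwarz companion: `|𝔡+𝔡′|²(θ) ≤ C₂₃₂(θ)·C₂₃₃(θ)` on `R_len` under the slot.
[cite: Zhang2022LandauSiegel, §2 after (2.33)] -/
theorem normSq_dSumS_le_inPrint (h : AdmissibleThetaLen θ) (hs : InPrintOffDiagonalRange θ) :
    ‖dSumS θ‖ ^ 2 ≤ C232S θ * C233T θ :=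
  normSq_dSumS_le θ (admissible_of_len_inPrint h hs)

/-- Printed-chain companion: no design of `R_len` with in-print off-diagonal input meets the printed
triple `C₂₃₂ < 0.001 ∧ C₂₃₃ < 3000 ∧ |𝔡+𝔡′|² > 25`. [cite: Zhang2022LandauSiegel, §2 Props. 2.4–2.5, (2.32)–(2.33)] -/
theorem not_printed_chain_inPrint (h : AdmissibleThetaLen θ) (hs : InPrintOffDiagonalRange θ) :
    ¬ (C232S θ < 1 / 1000 ∧ C233T θ < 3000 ∧ 25 < ‖dSumS θ‖ ^ 2) :=
  not_printed_chain_in_class θ (admissible_of_len_inPrint h hs)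

/-- **Boundary bonus (the calculus reaches the wall, the printed input stops before it)**: a design of
`R_len` of length `≤ P` — the wall `ν₁ = 1` INCLUDED, where the printed range already fails
(`not_inPrintControlled_of_one_le`) — still cannot close, by the calculus class `R_calc` alone
(`RepairAdmissibleWide.not_repairable_true_need_calc`, p456882): no slot needed.
[cite: Zhang2022LandauSiegel, §2 Props. 2.4–2.6, (2.32)–(2.33)] -/
theorem not_repairable_len_of_le_one (h : AdmissibleThetaLen θ) (h1 : θ.nu1 ≤ 1) :
    ¬ (C232S θ * C233T θ < ‖dSumS θ‖ ^ 2) :=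
  not_repairable_true_need_calc θ (h.toCalc h1)

/-! ### Non-vacuity of the class and load-bearing slot (C4) -/

/-- The printed point `θ₀` lies in `R_len`. [cite: Zhang2022LandauSiegel, §2 (2.21)–(2.26)] -/
theorem admissibleThetaLen_theta0 : AdmissibleThetaLen theta0 := admissible_theta0.toLen

/-- … and satisfies the slot (its top block `ρ = 0.504` is inside the large-sieve range).
[cite: Zhang2022LandauSiegel, §2 (2.21); §7 (7.15)] -/
theorem inPrintOffDiagonalRange_theta0 : InPrintOffDiagonalRange theta0 :=
  inPrintOffDiagonalRange_of_admissible admissible_theta0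

/-- The long designs: the printed parameters with the `H₁₁`-exponent replaced by `ν` (`P₁ = P^ν`).
[cite: Zhang2022LandauSiegel, §2 (2.21)–(2.26)] -/
def thetaLen (ν : ℝ) : Theta := { theta0 with nu1 := ν }

/-- `thetaLen ν ∈ R_len` for every `ν > 0.502` (`1 < ν + ν₃` with `ν₃ = 0.498`) — in particular for every
length `≥ P` (`ν ≥ 1`). [cite: Zhang2022LandauSiegel, §2 (2.21)–(2.26)] -/
theorem admissibleThetaLen_thetaLen {ν : ℝ} (h : 0.502 < ν) : AdmissibleThetaLen (thetaLen ν) := by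
  refine ⟨?_, ?_, ?_, ?_, ?_, ?_⟩
  · show (0.498 : ℝ) < 0.5 ∧ (0.5 : ℝ) < ν
    exact ⟨by norm_num, by linarith⟩
  · show (0.498 : ℝ) < 1 / 2 ∧ (0.5 : ℝ) ≤ 1 / 2 ∧ (1 : ℝ) / 2 < ν
    exact ⟨by norm_num, by norm_num, by linarith⟩
  · show (1 : ℝ) < ν + 0.498
    linarith
  · show (0.5 : ℝ) = 1 / 2
    norm_num
  · show ((0 : ℝ) < 3 / 2 ∧ (3 : ℝ) / 2 < 5) ∧ ((0 : ℝ) < 5 / 2 ∧ (5 : ℝ) / 2 < 5) ∧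
      ((0 : ℝ) < 3 / 2 ∧ (3 : ℝ) / 2 < 5)
    norm_num
  · show ((3 : ℝ) / 2) = 3 / 2
    rfl

/-- A long member (`ν = 21/20`, the length of `Repair.lengthKnifeEdge_witness`, and `ν = 2`).
[cite: Zhang2022LandauSiegel, §2 (2.21)–(2.26)] -/
theorem admissibleThetaLen_examples :
    AdmissibleThetaLen (thetaLen (21 / 20)) ∧ AdmissibleThetaLen (thetaLen 2) :=
  ⟨admissibleThetaLen_thetaLen (by norm_num), admissibleThetaLen_thetaLen (by norm_num)⟩

/-- **The slot is load-bearing**: at and beyond the wall it FAILS (`ν ≥ 1`) while membership holds — the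
verdict of `not_repairable_inPrint_lengths` is not a consequence of `K` alone, and such designs are not
decided here. [cite: Zhang2022LandauSiegel, §7 (7.2), (7.15)] -/
theorem not_inPrintOffDiagonalRange_thetaLen {ν : ℝ} (h : 1 ≤ ν) : ¬ InPrintOffDiagonalRange (thetaLen ν) := by
  intro hs
  have hP := belowP_of_inPrintOffDiagonalRange (θ := thetaLen ν) (by change (0:ℝ) ≤ ν; linarith) hs
  change ν < 1 at hP
  linarith

/-- … whereas `thetaLen ν` with `0.502 < ν < 1` is simply a class-`R` design (slot and verdict hold).
[cite: Zhang2022LandauSiegel, §2 (2.21)–(2.26); §7 (7.2)] -/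
theorem not_repairable_thetaLen_of_lt_one {ν : ℝ} (h : 0.502 < ν) (h1 : ν < 1) :
    InPrintOffDiagonalRange (thetaLen ν) ∧
      ¬ (C232S (thetaLen ν) * C233T (thetaLen ν) < ‖dSumS (thetaLen ν)‖ ^ 2) :=
  have hs : InPrintOffDiagonalRange (thetaLen ν) := inPrintOffDiagonalRange_of_belowP (by change ν < 1; exact h1)
  ⟨hs, not_repairable_inPrint_lengths _ (admissibleThetaLen_thetaLen h) hs⟩

/-! ### Extension protocol: the family and `R⁺ ++ [R_len]` -/

/-- family «`R_len`, T-true currency, in-print off-diagonal slot displayed in the verdict».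
[cite: Zhang2022LandauSiegel, §2 (2.32)–(2.33); §7 (7.2), (7.15)] -/
def familyInPrintLen : DesignFamily where
  Design := Theta
  InClass := AdmissibleThetaLen
  Verdict θ := InPrintOffDiagonalRange θ → ¬ (C232S θ * C233T θ < ‖dSumS θ‖ ^ 2)

/-- `R_len` is decided. [cite: Zhang2022LandauSiegel, §2 (2.32)–(2.33); §7 (7.2), (7.15)] -/
theorem familyInPrintLen_decided : familyInPrintLen.Decided := not_repairable_inPrint_lengths

/-- C2 at family level: every `familyR` design is a `familyInPrintLen` design, its slot holds, and the two
verdicts agree. [cite: Zhang2022LandauSiegel, §2 (2.32)–(2.33)] -/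
theorem familyR_inClass_toLen (θ : Theta) (h : familyR.InClass θ) :
    familyInPrintLen.InClass θ ∧ InPrintOffDiagonalRange θ ∧ (familyInPrintLen.Verdict θ ↔ familyR.Verdict θ) :=
  ⟨AdmissibleTheta.toLen h, inPrintOffDiagonalRange_of_admissible h,
    ⟨fun hv => hv (inPrintOffDiagonalRange_of_admissible h), fun hv _ => hv⟩⟩

/-- **`R⁺ ++ [R_len]` is decided** (for the running assembly `RepairRplusPlus`).
[cite: Zhang2022LandauSiegel, §2 (2.32)–(2.33); §7 (7.2), (7.15)] -/
theorem rplus_inPrintLen_decided : ClassDecided (Rplus ++ [familyInPrintLen]) :=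
  rplus_extend familyInPrintLen_decided

end Repair

end Literature.NumberTheory.LFunctions.Zhang2022
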